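import Mathlib.Analysis.Complex.TaylorSeries
import Mathlib.Analysis.Complex.Liouville

/-!
# ⟨27930⟩ NODE O, row F5 — THE TAYLOR-REMAINDER CAUCHY BRICK: order-`n` remainder of a holomorphic function of ONE complex
# variable from a sup bound on a disc (the `(L^jη)⁵` step of [I] (3.34) ⟶ (3.35)∕(3.54) ⟶ [II] (1.24)); generic, Mathlib-only

Cell `ym-nodeO-ideate`, porter ▶ PTC-1 g5 (count-neutral helper, `--supports stmt-QuantumFields-27930 --as helper`, NO `--workitem`),
on ★★★ director-ym №649 (4) (nodeO STATUS 2026-08-31T19:56:33Z): «F5 CHECK: does `Literature/…/B13Sect1Arith` Part B already give the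
Taylor-remainder Cauchy row at the shape `lemma1Printed_twoTorus_full` consumes (abstract analytic `E` on a polydisc, order 5)? … if a
port-shaped corollary is genuinely missing, ONE small helper file».  ANSWER (nodeO STATUS 20:02Z): NO — `B13Sect1Arith` Part B
(`norm_cauchy_t`, `cauchyOp`, `norm_cauchyOp_le`, `bound_124`) is the OUTER contour bookkeeping of [II] (1.23) ⇒ (1.24) and takes the
(I.3.54) bound `S = E₀(α₁∕α₃)⁵(L^jη)⁵exp(−κd_j(X))` as a HYPOTHESIS (`hS'`); the fifth-order Taylor-remainder ⇒ `(L^jη)⁵` step is this file.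
[I] = [Balaban1987RG1] (CMP **109** (1987) 249–301), [II] = [Balaban1988RG2Cluster] (CMP **116** (1988) 1–22).

PRINT.  [I] p. 277: the fundamental expansion (3.34) of `E(X, U_j(□₀, exp i(τB + B′))…)` «in B up to the fifth order», last term
`∫₀¹ dτ (1−τ)⁴∕4! (d⁵∕dτ⁵)(…)`; «By the definition of B and by the inequalities (3.32) we have |B| < O(1)L^jη, hence we expect that this
term can be bounded by O(1)exp(−κd_j(X))(O(1)L^jη)⁵. (3.35)»; p. 280 (3.54): the fifth τ-derivative represented by the Cauchy formula on a
circle `|σ| = r` and bounded by the sup of the (analytic, Lemma 4 (3.53)) integrand — «Because |B| < O(1)L^jη … we have the required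
bound».  [II] p. 7 (1.24) consumes exactly the factor `(L^jη)⁵`; in the tree `B13Lemma1TorusFull.lemma1Printed_twoTorus_full` displays it
as `((c.L:ℝ)^j * ((c.L:ℝ)^k)⁻¹)^5` in its binder `h124`.

WHAT (generic one-variable complex analysis; `E` a complete complex normed space, `f : ℂ → E` complex-differentiable on the open disc
`ball c R` and continuous on its closure, `‖f‖ ≤ S` on the circle `sphere c R` (§1–§2) or on the closed disc (§3)):
* §1 `norm_taylorSeriesTerm_le` — Cauchy's estimate per Taylor term: `‖(m!)⁻¹•(z−c)^m•f^{(m)}(c)‖ ≤ S·(‖z−c‖∕R)^m`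
  (Mathlib `Complex.norm_iteratedDeriv_le_of_forall_mem_sphere_norm_le`); `norm_sub_taylorPartialSum_le` — THE ORDER-`n` REMAINDER:
  `‖f z − Σ_{m<n} (m!)⁻¹•(z−c)^m•f^{(m)}(c)‖ ≤ S·q^n∕(1−q)`, `q = ‖z−c‖∕R < 1` (f equals its Taylor series on the disc, Mathlib
  `Complex.hasSum_taylorSeries_on_ball`, and the tail is dominated by the geometric series); `norm_sub_taylorPartialSum_le_two_mul` —
  the half-radius form `2‖z−c‖ ≤ R ⇒ ≤ 2·S·q^n`.
* §2 ★`norm_sub_taylorPartialSum_five_le` — THE PORT SHAPE of (I.3.54) ⟶ (II.1.24): expansion point `0`, evaluation at `τ = 1`, order 5,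
  analyticity radius `R = a∕(b·x)` («`|B| < b·x` with `x = L^jη` and analyticity for `|σB| < a`», `2·b·x ≤ a`) ⇒ remainder
  `≤ 2·S·(b∕a)^5·x^5` — instantiate `x := L^j·(L^k)⁻¹` to obtain `h124`'s factor literally; and the general-order twin
  `norm_sub_taylorPartialSum_le_pow`.
* §3 `norm_iteratedDeriv_le_of_mem_closedBall` — the print-literal (3.54) SUP FORM: for `‖τ − c‖ ≤ ρ < R`,
  `‖f^{(n)}(τ)‖ ≤ n!·S∕(R−ρ)^n` (Cauchy's estimate on the circle of radius `R − ρ` about `τ`), whence a consumer who keeps the integral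
  form `∫₀¹(1−τ)⁴∕4!·f^{(5)}(τ)dτ` of the remainder bounds it by `S∕(R−1)^5` (`∫₀¹(1−τ)⁴∕4! dτ = 1∕5!`).

HONEST.  Mathlib-level lemmas (Cauchy estimates + convergence of the Taylor series on a disc); NOT (I.3.54) itself: the DOMAIN statement
(the configuration `U_j(□₀, exp i(σB + B′))…` stays in `U^c_j(X, α₀, α₁)` for `|σ| ≤ r` — [I] Lemma 4 (3.53), the node's row F4) and the
SUP BOUND `E₀exp(−κd_j(X))` of the integrand (the inductive hypothesis (1.18)) are the consumer's displayed inputs `hf`∕`hS`; the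
localisation remark of p. 280 («this bound holds on □̃⁴ only …») is not touched.  Nothing of [I]∕[II] is ported or discharged; `stub_P0C`,
S₃, F and every letter of ⟨27930⟩ stay OPEN; K0ᴬ ⟨27238⟩, K0⁷ OPEN; NODE O 0∕1; COUNT 8∕28 · K 1∕4 UNMOVED; finite 𝕋⁴ at fixed ε — NOT
continuum ∕ OS ∕ Clay; the Yang–Mills mass gap is NOT proved by any of this.
-/

namespace Summit.QuantumFields.YangMills.Theorems.F5TaylorRemainderCauchy

open Metric Finset
open scoped Nat

variable {E : Type*} [NormedAddCommGroup E] [NormedSpace ℂ E] [CompleteSpace E]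

/-! ## §1  Cauchy's estimate per Taylor term and the order-`n` remainder on a disc -/

omit [NormedSpace ℂ E] [CompleteSpace E] in
/-- A sup bound on a circle of positive radius is non-negative (the circle is non-empty). [folklore] -/
theorem nonneg_of_forall_mem_sphere_norm_le {f : ℂ → E} {c : ℂ} {R S : ℝ} (hR : 0 < R)
    (hS : ∀ w ∈ sphere c R, ‖f w‖ ≤ S) : 0 ≤ S := by
  have hmem : c + (R : ℂ) ∈ sphere c R := by
    simp [abs_of_pos hR]
  exact (norm_nonneg _).trans (hS _ hmem)

/-- **Cauchy's estimate per Taylor term.**  `f` complex-differentiable on `ball c R`, continuous on its closure, `‖f‖ ≤ S` on the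
circle `sphere c R` (`R > 0`): the `m`-th Taylor term at `c` evaluated at `z` has norm `≤ S·(‖z−c‖∕R)^m`
(`‖f^{(m)}(c)‖ ≤ m!·S∕R^m`, Mathlib `Complex.norm_iteratedDeriv_le_of_forall_mem_sphere_norm_le`). [folklore]
[cite: Balaban1987RG1, (3.54) p.280] -/
theorem norm_taylorSeriesTerm_le {f : ℂ → E} {c z : ℂ} {R S : ℝ} (hR : 0 < R)
    (hf : DiffContOnCl ℂ f (ball c R)) (hS : ∀ w ∈ sphere c R, ‖f w‖ ≤ S) (m : ℕ) :
    ‖(m ! : ℂ)⁻¹ • (z - c) ^ m • iteratedDeriv m f c‖ ≤ S * (‖z - c‖ / R) ^ m := by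
  have hC := Complex.norm_iteratedDeriv_le_of_forall_mem_sphere_norm_le m hR hf hS
  have hm : (0 : ℝ) < m ! := by exact_mod_cast Nat.factorial_pos m
  rw [norm_smul, norm_smul, norm_inv, Complex.norm_natCast, norm_pow, div_pow]
  calc (m ! : ℝ)⁻¹ * (‖z - c‖ ^ m * ‖iteratedDeriv m f c‖)
      ≤ (m ! : ℝ)⁻¹ * (‖z - c‖ ^ m * (m ! * S / R ^ m)) := by
        gcongr
    _ = S * (‖z - c‖ ^ m / R ^ m) := by
        field_simp

/-- **THE ORDER-`n` TAYLOR REMAINDER OF A HOLOMORPHIC FUNCTION FROM A SUP BOUND ON A DISC.**  `f` complex-differentiable on `ball c R`,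
continuous on its closure, `‖f‖ ≤ S` on `sphere c R`, `z` in the open disc, `q := ‖z−c‖∕R` (so `q < 1`): for every `n`,
`‖f z − Σ_{m<n} (m!)⁻¹•(z−c)^m•f^{(m)}(c)‖ ≤ S·q^n∕(1−q)` — `f` is the sum of its Taylor series on the disc (Mathlib
`Complex.hasSum_taylorSeries_on_ball`), the tail from `n` on is dominated termwise by `S·q^m` (`norm_taylorSeriesTerm_le`), and
`Σ_{m≥n} S·q^m = S·q^n∕(1−q)`.  This is the Cauchy-formula bound of the last term of [I] (3.34) ((3.54) p. 280) in series form.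
[cite: Balaban1987RG1, (3.34)–(3.35) p.277, (3.54) p.280] -/
theorem norm_sub_taylorPartialSum_le {f : ℂ → E} {c z : ℂ} {R S : ℝ} (hR : 0 < R)
    (hf : DiffContOnCl ℂ f (ball c R)) (hS : ∀ w ∈ sphere c R, ‖f w‖ ≤ S) (hz : z ∈ ball c R) (n : ℕ) :
    ‖f z - ∑ m ∈ range n, (m ! : ℂ)⁻¹ • (z - c) ^ m • iteratedDeriv m f c‖
      ≤ S * (‖z - c‖ / R) ^ n / (1 - ‖z - c‖ / R) := by
  set q : ℝ := ‖z - c‖ / R with hq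
  have hzc : ‖z - c‖ < R := by rwa [mem_ball, dist_eq_norm] at hz
  have hq0 : 0 ≤ q := div_nonneg (norm_nonneg _) hR.le
  have hq1 : q < 1 := (div_lt_one hR).2 hzc
  have hsum := Complex.hasSum_taylorSeries_on_ball hf.differentiableOn hz
  have htail := (hasSum_nat_add_iff' n).2 hsum
  have hgeom : HasSum (fun m : ℕ => S * q ^ n * q ^ m) (S * q ^ n * (1 - q)⁻¹) :=
    (hasSum_geometric_of_lt_one hq0 hq1).mul_left (S * q ^ n)
  have hle : ∀ m : ℕ, ‖((m + n) ! : ℂ)⁻¹ • (z - c) ^ (m + n) • iteratedDeriv (m + n) f c‖ ≤ S * q ^ n * q ^ m :=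
    fun m => by
      calc _ ≤ S * q ^ (m + n) := norm_taylorSeriesTerm_le hR hf hS (m + n)
        _ = S * q ^ n * q ^ m := by rw [pow_add]; ring
  have key := HasSum.norm_le_of_bounded htail hgeom hle
  simpa [div_eq_mul_inv] using key

/-- **Half-radius form.**  If moreover `2‖z−c‖ ≤ R` then `q ≤ ½`, `1∕(1−q) ≤ 2`, and the order-`n` remainder is `≤ 2·S·(‖z−c‖∕R)^n`.
[cite: Balaban1987RG1, (3.35) p.277, (3.54) p.280] -/
theorem norm_sub_taylorPartialSum_le_two_mul {f : ℂ → E} {c z : ℂ} {R S : ℝ} (hR : 0 < R)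
    (hf : DiffContOnCl ℂ f (ball c R)) (hS : ∀ w ∈ sphere c R, ‖f w‖ ≤ S) (h2 : 2 * ‖z - c‖ ≤ R) (n : ℕ) :
    ‖f z - ∑ m ∈ range n, (m ! : ℂ)⁻¹ • (z - c) ^ m • iteratedDeriv m f c‖
      ≤ 2 * S * (‖z - c‖ / R) ^ n := by
  have hzc : ‖z - c‖ < R := by linarith [norm_nonneg (z - c)]
  have hz : z ∈ ball c R := by rwa [mem_ball, dist_eq_norm]
  have hS0 : 0 ≤ S := nonneg_of_forall_mem_sphere_norm_le hR hS
  set q : ℝ := ‖z - c‖ / R with hq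
  have hq0 : 0 ≤ q := div_nonneg (norm_nonneg _) hR.le
  have hqh : q ≤ 1 / 2 := by
    rw [hq, div_le_iff₀ hR]; linarith
  have key := norm_sub_taylorPartialSum_le hR hf hS hz n
  refine key.trans ?_
  rw [div_le_iff₀ (by linarith)]
  have hqn : 0 ≤ S * q ^ n := mul_nonneg hS0 (pow_nonneg hq0 n)
  nlinarith

/-! ## §2  The port shape: expansion point `0`, evaluation at `τ = 1`, radius `a∕(b·x)` — the `x^n` (`(L^jη)⁵`) factor -/

/-- **General order, port shape.**  Expansion at `0`, evaluation at `1` (the `τ = 1` endpoint of the background-field expansion);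
`f` complex-differentiable on the disc of radius `R = a∕(b·x)` about `0` and continuous on its closure, `‖f‖ ≤ S` on its boundary
circle, with `0 < a`, `0 < b`, `0 < x` and `2·b·x ≤ a` (the small parameter `x` — print's `L^jη` — against the analyticity radius
`a` in the direction `B`, `|B| < b·x`): `‖f 1 − Σ_{m<n} (m!)⁻¹•f^{(m)}(0)‖ ≤ 2·S·(b∕a)^n·x^n`.
[cite: Balaban1987RG1, (3.35) p.277, (3.54) p.280; Balaban1988RG2Cluster, (1.24) p.7] -/
theorem norm_sub_taylorPartialSum_le_pow {f : ℂ → E} {a b x S : ℝ} (ha : 0 < a) (hb : 0 < b) (hx : 0 < x)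
    (hbx : 2 * b * x ≤ a) (hf : DiffContOnCl ℂ f (ball 0 (a / (b * x))))
    (hS : ∀ w ∈ sphere (0 : ℂ) (a / (b * x)), ‖f w‖ ≤ S) (n : ℕ) :
    ‖f 1 - ∑ m ∈ range n, (m ! : ℂ)⁻¹ • iteratedDeriv m f 0‖ ≤ 2 * S * (b / a) ^ n * x ^ n := by
  have hbx0 : 0 < b * x := mul_pos hb hx
  have hR : 0 < a / (b * x) := div_pos ha hbx0
  have h2 : 2 * ‖(1 : ℂ) - 0‖ ≤ a / (b * x) := by
    rw [sub_zero, norm_one, mul_one, le_div_iff₀ hbx0]; linarith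
  have key := norm_sub_taylorPartialSum_le_two_mul hR hf hS h2 n
  have e1 : ‖(1 : ℂ) - 0‖ / (a / (b * x)) = b / a * x := by
    rw [sub_zero, norm_one]; field_simp
  simp only [sub_zero, one_pow, one_smul] at key
  rw [sub_zero, norm_one] at e1
  calc ‖f 1 - ∑ m ∈ range n, (m ! : ℂ)⁻¹ • iteratedDeriv m f 0‖
      ≤ 2 * S * (1 / (a / (b * x))) ^ n := by simpa using key
    _ = 2 * S * (b / a) ^ n * x ^ n := by
        rw [one_div, show (a / (b * x))⁻¹ = b / a * x by field_simp, mul_pow]; ring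

/-- ★ **THE PORT SHAPE OF (I.3.54) ⟶ (II.1.24), ORDER FIVE.**  With the data of `norm_sub_taylorPartialSum_le_pow`:
`‖f 1 − Σ_{m<5} (m!)⁻¹•f^{(m)}(0)‖ ≤ 2·S·(b∕a)^5·x^5` — the last term of the fifth-order expansion [I] (3.34) at `τ = 1` is bounded by
the sup bound `S` (print: `E₀exp(−κd_j(X))`, the inductive hypothesis, through Lemma 4 (3.53)) times `(O(1)·L^jη)⁵` ([I] (3.35));
with `x := L^j·(L^k)⁻¹` this is the factor `((c.L:ℝ)^j * ((c.L:ℝ)^k)⁻¹)^5` of `B13Lemma1TorusFull.lemma1Printed_twoTorus_full`'s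
binder `h124` ([II] (1.24)), the constant `2·S·(b∕a)^5` going into its `K`. [cite: Balaban1987RG1, (3.34)–(3.35) p.277, (3.54) p.280;
Balaban1988RG2Cluster, (1.24) p.7] -/
theorem norm_sub_taylorPartialSum_five_le {f : ℂ → E} {a b x S : ℝ} (ha : 0 < a) (hb : 0 < b) (hx : 0 < x)
    (hbx : 2 * b * x ≤ a) (hf : DiffContOnCl ℂ f (ball 0 (a / (b * x))))
    (hS : ∀ w ∈ sphere (0 : ℂ) (a / (b * x)), ‖f w‖ ≤ S) :
    ‖f 1 - ∑ m ∈ range 5, (m ! : ℂ)⁻¹ • iteratedDeriv m f 0‖ ≤ 2 * S * (b / a) ^ 5 * x ^ 5 :=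
  norm_sub_taylorPartialSum_le_pow ha hb hx hbx hf hS 5

/-! ## §3  The sup form of (3.54): Cauchy's estimate for `f^{(n)}` at every point of a smaller closed disc -/

/-- **Cauchy's estimate off-centre (the print-literal (3.54) sup form).**  `f` complex-differentiable on `ball c R`, continuous on its
closure, `‖f‖ ≤ S` on the CLOSED disc `closedBall c R`; then at every `τ` with `‖τ − c‖ ≤ ρ`, `ρ < R`:
`‖f^{(n)}(τ)‖ ≤ n!·S∕(R−ρ)^n` (Cauchy's estimate on the circle of radius `R − ρ` about `τ`, which lies in the closed disc).  With
`c = 0`, `ρ = 1` this bounds `sup_{τ∈[0,1]} ‖f^{(5)}(τ)‖` by `5!·S∕(R−1)^5`, so the integral form `∫₀¹(1−τ)⁴∕4!·f^{(5)}(τ)dτ` of the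
last term of (3.34) is `≤ S∕(R−1)^5` (`∫₀¹(1−τ)⁴∕4! dτ = 1∕5!`). [cite: Balaban1987RG1, (3.54) p.280] -/
theorem norm_iteratedDeriv_le_of_mem_closedBall {f : ℂ → E} {c τ : ℂ} {R ρ S : ℝ} (hρR : ρ < R)
    (hf : DiffContOnCl ℂ f (ball c R)) (hS : ∀ w ∈ closedBall c R, ‖f w‖ ≤ S) (hτ : τ ∈ closedBall c ρ) (n : ℕ) :
    ‖iteratedDeriv n f τ‖ ≤ n ! * S / (R - ρ) ^ n := by
  have hr : 0 < R - ρ := sub_pos.2 hρR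
  have hτc : dist τ c ≤ ρ := mem_closedBall.1 hτ
  have hsub : ball τ (R - ρ) ⊆ ball c R := ball_subset_ball' (by linarith)
  have hf' : DiffContOnCl ℂ f (ball τ (R - ρ)) := hf.mono hsub
  refine Complex.norm_iteratedDeriv_le_of_forall_mem_sphere_norm_le n hr hf' fun w hw => hS w ?_
  rw [mem_closedBall]
  have hw' : dist w τ = R - ρ := mem_sphere.1 hw
  linarith [dist_triangle w τ c]

end Summit.QuantumFields.YangMills.Theorems.F5TaylorRemainderCauchy
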